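import Mathlib
import Literature.Analysis.FluidPDE.HardSphereCollisionRecord
import Literature.Analysis.FluidPDE.HardSphereTorusMeasure
import Literature.Analysis.FluidPDE.HardSphereEuclideanTransfer
import Literature.MathematicalPhysics.KineticTheory.HardSphereEuler
import Literature.MathematicalPhysics.KineticTheory.HardSphereEulerProofs
import Summits.AtomisticToContinuum.HydrodynamicLimit.Theorems.OneFlightGossipEngineOneFlightLayeredChaosEntranceLaw
import HarnessLib

/-!
# `OneFlightGossipEngine.OneFlightLayeredChaos` — brick B3: the entrance law of two free flights on the torus
(crux stmt-AtomisticToContinuum-14535, line `Sketch`, first-rung reduction; registered stub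
`lintegral_entranceLaw_torus`).

Two tagged spheres fly freely on `𝕋³`; with relative position `y ∈ 𝕋³` and relative velocity `g ≠ 0` their
minimal-image separation at time `t` is `reprSym (y + proj (t g))`.  The ENTRANCE TIME is
`t⋆(y) = inf {t > 0 | ‖reprSym (y + proj (t g))‖ ≤ ε}` (junk `0` when the set is empty or accumulates at `0`) and
the contact normal is `ω⋆(y) = ε⁻¹ reprSym (y + proj (t⋆ g))`.  **Brick B3**: for `y` Haar-distributed on `𝕋³`,
the pair `(t⋆, ω⋆)` restricted to `t⋆ ∈ (0, w]` has the law `dt ⊗ ε² (−⟪ω, g⟫)₊ dS(ω)` — provided no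
wrap-around can occur in the window: `ε < 1/4` and `‖g‖ w ≤ 1/4`.

Proof.  (a) The torus integrand is, pointwise in `y`, an explicit Euclidean function of the minimal image
`q = reprSym y ∈ (-1/2, 1/2]³` (`torusIntegrand_eq_indicator_reprSym`): with the first hitting time
`τ(q) = pairHitTime ε q g` of `HardSphereBilliard` (smaller root of `‖q + t g‖² = ε²`) it equals
`1_{disc ≥ 0, τ(q) ∈ (0, w]} · H (τ q, ε⁻¹ (q + τ(q) g))`.  Indeed inside the window everything happens in the
Euclidean ball of radius `ε + w ‖g‖ < 1/2`, where the chart `reprSym ∘ proj = id` is faithful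
(`Torus.reprSym_proj_of_norm_lt`); the torus entrance time is then the Euclidean first entrance, which is
characterised by "inside at `T₀`, outside on `(0, T₀)`" (`pairHitTime_eq_of_first_entrance`).
(b) `reprSym` pushes Haar measure to Lebesgue measure on the cube (`Torus.measurePreserving_reprSym`), and the
Euclidean integrand is supported in the ball of radius `ε + w‖g‖ < 1/2 ⊆` cube, so the `y`-integral is a Euclidean
integral over `ℝ³`.  (c) Up to the null grazing cylinder `{disc = 0}` (`volume_setOf_pairDisc_eq_zero`) the
support condition `disc ≥ 0` is membership in the open tube `{q | dist (q, ℝ g) < ε} = {disc > 0}`, and on the tube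
the Euclidean entrance law `lintegral_entranceLaw_pair` (brick of cycle c3) with the explicit measurable left
inverse `(τ, ε⁻¹(q + τ g))` of `(t, ω) ↦ ε ω − t g` gives `∫_S ∫_{(0,w]} H(t, ω) ε² (−⟪ω, g⟫)₊ dt dS(ω)`.

References: C. Cercignani, R. Illner, M. Pulvirenti, *The Mathematical Theory of Dilute Gases* (1994), App. 4.A
(the cylinder change of variables); I. Gallagher, L. Saint-Raymond, B. Texier, *From Newton to Boltzmann* (2013),
Ch. 4 intro (minimal image on `𝕋^d`).
-/

open MeasureTheory Metric Real Set
open scoped InnerProductSpace ENNReal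
open Literature.Analysis.FluidPDE Literature.Analysis.FunctionSpaces Literature.MathematicalPhysics.KineticTheory

namespace Summit.AtomisticToContinuum.HydrodynamicLimit.Theorems.OLC

/-! ## Euclidean kinematics of the line `q + t g` against the ball of radius `ε` -/

section Euclid

variable {E : Type*} [NormedAddCommGroup E] [InnerProductSpace ℝ E]

/-- Completing the square: `‖q + s g‖² − ε² = ‖g‖² (s + ⟪q, g⟫/‖g‖²)² − disc/‖g‖²`. [folklore] -/
theorem norm_add_smul_sq_sub_eq_square {g : E} (hg : g ≠ 0) (ε : ℝ) (q : E) (s : ℝ) :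
    ‖q + s • g‖ ^ 2 - ε ^ 2 =
      ‖g‖ ^ 2 * (s + ⟪q, g⟫_ℝ / ‖g‖ ^ 2) ^ 2 - pairDisc ε q g / ‖g‖ ^ 2 := by
  have ha : ‖g‖ ^ 2 ≠ 0 := pow_ne_zero 2 (norm_ne_zero_iff.2 hg)
  rw [norm_add_smul_sq_sub, pairDisc]
  field_simp
  ring

/-- Factorisation of `‖q + s g‖² − ε²` by its two roots when `disc ≥ 0`: the smaller root is
`pairHitTime ε q g`. [folklore] -/
theorem norm_add_smul_sq_sub_eq_mul_roots {g : E} (hg : g ≠ 0) {ε : ℝ} {q : E} (hD : 0 ≤ pairDisc ε q g)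
    (s : ℝ) :
    ‖q + s • g‖ ^ 2 - ε ^ 2 =
      ‖g‖ ^ 2 * (pairHitTime ε q g - s) * ((-⟪q, g⟫_ℝ + Real.sqrt (pairDisc ε q g)) / ‖g‖ ^ 2 - s) := by
  have ha : ‖g‖ ^ 2 ≠ 0 := pow_ne_zero 2 (norm_ne_zero_iff.2 hg)
  have hs2 : Real.sqrt (pairDisc ε q g) ^ 2 = pairDisc ε q g := Real.sq_sqrt hD
  rw [norm_add_smul_sq_sub, pairHitTime]
  rw [pairDisc] at hs2 ⊢
  generalize Real.sqrt (⟪q, g⟫_ℝ ^ 2 - ‖g‖ ^ 2 * (‖q‖ ^ 2 - ε ^ 2)) = r at hs2 ⊢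
  generalize ‖g‖ ^ 2 = a at ha hs2 ⊢
  field_simp
  linear_combination hs2

/-- If the discriminant is nonnegative and the first hitting time is positive then the pair is approaching
(`PairHits`). [folklore] -/
theorem pairHits_of_pairHitTime_pos {g : E} (hg : g ≠ 0) {ε : ℝ} {q : E} (hD : 0 ≤ pairDisc ε q g)
    (hτ : 0 < pairHitTime ε q g) : PairHits ε q g := by
  refine ⟨?_, hD⟩
  have ha : 0 < ‖g‖ ^ 2 := pow_pos (norm_pos_iff.2 hg) 2
  rw [pairHitTime, div_pos_iff_of_pos_right ha] at hτ
  linarith [Real.sqrt_nonneg (pairDisc ε q g)]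

/-- **First entrance along a line.** If `g ≠ 0`, `q + T₀ g` (`T₀ > 0`) lies in the closed ball of radius `ε ≥ 0`
and `q + s g` lies strictly outside for every `s ∈ (0, T₀)`, then the line meets the ball (`disc ≥ 0`) and `T₀`
is the first hitting time `pairHitTime ε q g`. [folklore] -/
theorem pairHitTime_eq_of_first_entrance {g : E} (hg : g ≠ 0) {ε : ℝ} (hε : 0 ≤ ε) {q : E} {T₀ : ℝ}
    (hT₀ : 0 < T₀) (hin : ‖q + T₀ • g‖ ≤ ε) (hout : ∀ s ∈ Ioo 0 T₀, ε < ‖q + s • g‖) :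
    0 ≤ pairDisc ε q g ∧ pairHitTime ε q g = T₀ := by
  have ha : 0 < ‖g‖ ^ 2 := pow_pos (norm_pos_iff.2 hg) 2
  have hQ0 : ‖q + T₀ • g‖ ^ 2 - ε ^ 2 ≤ 0 := sub_nonpos.2 (pow_le_pow_left₀ (norm_nonneg _) hin 2)
  have hD : 0 ≤ pairDisc ε q g := by
    by_contra hneg
    push Not at hneg
    rw [norm_add_smul_sq_sub_eq_square hg] at hQ0
    have h1 : 0 ≤ ‖g‖ ^ 2 * (T₀ + ⟪q, g⟫_ℝ / ‖g‖ ^ 2) ^ 2 := by positivity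
    have h2 : pairDisc ε q g / ‖g‖ ^ 2 < 0 := div_neg_of_neg_of_pos hneg ha
    linarith
  refine ⟨hD, ?_⟩
  set t₁ := pairHitTime ε q g with ht₁
  set t₂ := (-⟪q, g⟫_ℝ + Real.sqrt (pairDisc ε q g)) / ‖g‖ ^ 2 with ht₂
  have h12 : t₁ ≤ t₂ :=
    div_le_div_of_nonneg_right (by linarith [Real.sqrt_nonneg (pairDisc ε q g)]) ha.le
  have hfac : ∀ s, ‖q + s • g‖ ^ 2 - ε ^ 2 = ‖g‖ ^ 2 * (t₁ - s) * (t₂ - s) :=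
    norm_add_smul_sq_sub_eq_mul_roots hg hD
  -- `t₁ ≤ T₀`
  have hle : t₁ ≤ T₀ := by
    by_contra hlt
    push Not at hlt
    have : 0 < ‖g‖ ^ 2 * (t₁ - T₀) * (t₂ - T₀) :=
      mul_pos (mul_pos ha (by linarith)) (by linarith)
    linarith [hfac T₀]
  -- `T₀ ≤ t₂`
  have hle2 : T₀ ≤ t₂ := by
    by_contra hlt
    push Not at hlt
    have : 0 < ‖g‖ ^ 2 * (t₁ - T₀) * (t₂ - T₀) := by
      rw [mul_assoc]
      exact mul_pos ha (mul_pos_of_neg_of_neg (by linarith) (by linarith))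
    linarith [hfac T₀]
  refine le_antisymm hle ?_
  by_contra hlt
  push Not at hlt
  obtain ⟨s, hs1, hs2⟩ := exists_between (max_lt hlt hT₀)
  have hs0 : 0 < s := lt_of_le_of_lt (le_max_right _ _) hs1
  have hst : t₁ < s := lt_of_le_of_lt (le_max_left _ _) hs1
  have hQs : 0 < ‖q + s • g‖ ^ 2 - ε ^ 2 :=
    sub_pos.2 (pow_lt_pow_left₀ (hout s ⟨hs0, hs2⟩) hε two_ne_zero)
  have : ‖g‖ ^ 2 * (t₁ - s) * (t₂ - s) ≤ 0 := by
    rw [mul_assoc]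
    exact mul_nonpos_iff.2 (Or.inl ⟨ha.le, mul_nonpos_iff.2 (Or.inr ⟨by linarith, by linarith⟩)⟩)
  linarith [hfac s]

/-- **The open tube around the line `ℝ g` is `{disc > 0}`.** [folklore] -/
theorem exists_dist_smul_lt_iff_pairDisc_pos {g : E} (hg : g ≠ 0) {ε : ℝ} (hε : 0 < ε) (q : E) :
    (∃ t : ℝ, dist q (t • g) < ε) ↔ 0 < pairDisc ε q g := by
  have ha : 0 < ‖g‖ ^ 2 := pow_pos (norm_pos_iff.2 hg) 2
  constructor
  · rintro ⟨t, ht⟩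
    rw [dist_eq_norm, sub_eq_add_neg, ← neg_smul] at ht
    have hQ : ‖q + (-t) • g‖ ^ 2 - ε ^ 2 < 0 :=
      sub_neg.2 (pow_lt_pow_left₀ ht (norm_nonneg _) two_ne_zero)
    rw [norm_add_smul_sq_sub_eq_square hg] at hQ
    have h1 : 0 ≤ ‖g‖ ^ 2 * (-t + ⟪q, g⟫_ℝ / ‖g‖ ^ 2) ^ 2 := by positivity
    have h2 : 0 < pairDisc ε q g / ‖g‖ ^ 2 := by linarith
    exact (div_pos_iff_of_pos_right ha).1 h2
  · intro hD
    refine ⟨⟪q, g⟫_ℝ / ‖g‖ ^ 2, ?_⟩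
    rw [dist_eq_norm, sub_eq_add_neg, ← neg_smul]
    have hQ : ‖q + (-(⟪q, g⟫_ℝ / ‖g‖ ^ 2)) • g‖ ^ 2 - ε ^ 2 < 0 := by
      rw [norm_add_smul_sq_sub_eq_square hg, neg_add_cancel]
      have : 0 < pairDisc ε q g / ‖g‖ ^ 2 := div_pos hD ha
      nlinarith
    exact lt_of_pow_lt_pow_left₀ 2 hε.le (by linarith)

/-- **The explicit left inverse of the entrance parametrisation `(t, ω) ↦ ε ω − t g`** on the incoming hemisphere:
the first hitting time of `ε ω − t g` is `t` and the normalised hit point is `ω`. [folklore] -/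
theorem pairHitTime_entrance_leftInverse {g : E} (hg : g ≠ 0) {ε : ℝ} (hε : 0 < ε) (t : ℝ) (ω : E)
    (hω : ‖ω‖ = 1) (hin : ⟪g, ω⟫_ℝ < 0) :
    pairHitTime ε (ε • ω - t • g) g = t ∧
      ε⁻¹ • ((ε • ω - t • g) + pairHitTime ε (ε • ω - t • g) g • g) = ω := by
  have hnorm : ‖ε • ω‖ = ε := by rw [norm_smul, Real.norm_of_nonneg hε.le, hω, mul_one]
  have hhits : PairHits ε (ε • ω) g := by
    refine ⟨?_, ?_⟩
    · rw [real_inner_smul_left, real_inner_comm]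
      exact mul_neg_of_pos_of_neg hε hin
    · simp only [pairDisc, hnorm, sub_self, mul_zero, sub_zero]
      exact sq_nonneg _
  have h0 : pairHitTime ε (ε • ω) g = 0 := (pairHitTime_eq_zero_iff hε.le hhits).2 hnorm
  have h1 : pairHitTime ε (ε • ω - t • g) g = t := by
    rw [sub_eq_add_neg, ← neg_smul, pairHitTime_add_smul ε (ε • ω) g hg (-t), h0]
    ring
  refine ⟨h1, ?_⟩
  rw [h1, sub_add_cancel, smul_smul, inv_mul_cancel₀ hε.ne', one_smul]

end Euclid

/-! ## An entrance time of a continuous function is attained -/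

/-- For a continuous `φ`: if `inf {t > 0 | φ t ≤ c} > 0` then `φ ≤ c` there (the infimum is attained). [folklore] -/
theorem apply_sInf_le_of_pos {φ : ℝ → ℝ} (hφ : Continuous φ) {c : ℝ}
    (h : 0 < sInf {t : ℝ | 0 < t ∧ φ t ≤ c}) : φ (sInf {t : ℝ | 0 < t ∧ φ t ≤ c}) ≤ c := by
  set S : Set ℝ := {t : ℝ | 0 < t ∧ φ t ≤ c} with hS
  have hne : S.Nonempty := by
    by_contra hne
    rw [Set.not_nonempty_iff_eq_empty] at hne
    rw [hne, Real.sInf_empty] at h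
    exact lt_irrefl 0 h
  have hbdd : BddBelow S := ⟨0, fun t ht => ht.1.le⟩
  have hcl : closure S ⊆ {t | φ t ≤ c} :=
    closure_minimal (fun t ht => ht.2) (isClosed_le hφ continuous_const)
  exact hcl (csInf_mem_closure hne hbdd)

/-! ## The torus chart: the torus integrand as a Euclidean function of the minimal image -/

/-- **Pointwise identification.** For `g ≠ 0`, `0 < ε < 1/4`, `‖g‖ w ≤ 1/4` and any `H`, the torus
integrand `1_{(0,w]}(t⋆ y) · H (t⋆ y, ε⁻¹ reprSym (y + proj (t⋆ g)))` at `y ∈ 𝕋³` equals the Euclidean integrand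
`1_{disc ≥ 0, τ ∈ (0,w]}(q) · H (τ q, ε⁻¹ (q + τ(q) g))` at the minimal image `q = reprSym y`, where
`τ = pairHitTime ε · g`. [folklore] -/
theorem torusIntegrand_eq_indicator_reprSym {g : V3} (hg : g ≠ 0) {ε w : ℝ} (hε : 0 < ε) (hε4 : ε < 4⁻¹)
    (hgw : ‖g‖ * w ≤ 4⁻¹) (H : ℝ × V3 → ℝ≥0∞) (y : T3) :
    (Ioc 0 w).indicator (fun _ => (1 : ℝ≥0∞))
        (sInf {t : ℝ | 0 < t ∧ ‖Torus.reprSym (y + Torus.proj (t • g))‖ ≤ ε}) *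
      H (sInf {t : ℝ | 0 < t ∧ ‖Torus.reprSym (y + Torus.proj (t • g))‖ ≤ ε},
        ε⁻¹ • Torus.reprSym (y + Torus.proj
          ((sInf {t : ℝ | 0 < t ∧ ‖Torus.reprSym (y + Torus.proj (t • g))‖ ≤ ε}) • g))) =
    {q : V3 | 0 ≤ pairDisc ε q g ∧ pairHitTime ε q g ∈ Ioc 0 w}.indicator
      (fun q => H (pairHitTime ε q g, ε⁻¹ • (q + pairHitTime ε q g • g))) (Torus.reprSym y) := by
  set q : V3 := Torus.reprSym y with hq
  have hyq : y = Torus.proj q := (Torus.proj_reprSym y).symm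
  set T : Set ℝ := {t : ℝ | 0 < t ∧ ‖Torus.reprSym (y + Torus.proj (t • g))‖ ≤ ε} with hT
  have hbdd : BddBelow T := ⟨0, fun t ht => ht.1.le⟩
  have hhalf : ε + w * ‖g‖ < 1 / 2 := by nlinarith
  -- the chart: for `‖q + t g‖ < 1/2` the minimal image of `y + proj (t g)` is `q + t g`
  have chart : ∀ t : ℝ, ‖q + t • g‖ < 1 / 2 → Torus.reprSym (y + Torus.proj (t • g)) = q + t • g := by
    intro t ht
    rw [hyq, ← Torus.proj_add]
    exact Torus.reprSym_proj_of_norm_lt ht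
  -- moving back along the flight inside the window stays in the chart
  have back : ∀ {p : V3} {s : ℝ}, ‖p‖ ≤ ε → 0 ≤ s → s ≤ w → ‖p - s • g‖ < 1 / 2 := by
    intro p s hp hs0 hsw
    calc ‖p - s • g‖ ≤ ‖p‖ + ‖s • g‖ := norm_sub_le _ _
      _ = ‖p‖ + s * ‖g‖ := by rw [norm_smul, Real.norm_of_nonneg hs0]
      _ ≤ ε + w * ‖g‖ := add_le_add hp (mul_le_mul_of_nonneg_right hsw (norm_nonneg g))
      _ < 1 / 2 := hhalf
  by_cases hA : q ∈ {q : V3 | 0 ≤ pairDisc ε q g ∧ pairHitTime ε q g ∈ Ioc 0 w}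
  · -- inside the window: the torus entrance time is the Euclidean first hitting time
    rw [indicator_of_mem hA]
    obtain ⟨hD, hτ0, hτw⟩ := hA
    set τ := pairHitTime ε q g with hτdef
    have hPH : PairHits ε q g := pairHits_of_pairHitTime_pos hg hD hτ0
    have hnorm : ‖q + τ • g‖ = ε := norm_add_pairHitTime_smul hε.le hPH
    have hlt_half : ∀ t, 0 ≤ t → t ≤ τ → ‖q + t • g‖ < 1 / 2 := by
      intro t ht0 htτ
      have : q + t • g = (q + τ • g) - (τ - t) • g := by rw [sub_smul]; abel
      rw [this]
      exact back hnorm.le (by linarith) (by linarith)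
    have hsInf : sInf T = τ := by
      refine IsLeast.csInf_eq ⟨⟨hτ0, ?_⟩, fun t ht => ?_⟩
      · rw [chart τ (hlt_half τ hτ0.le le_rfl), hnorm]
      · by_contra hlt
        push Not at hlt
        have h1 := lt_norm_add_smul_of_lt_pairHitTime hPH hlt
        rw [← chart t (hlt_half t ht.1.le hlt.le)] at h1
        exact (not_le.2 h1) ht.2
    rw [hsInf, indicator_of_mem (show τ ∈ Ioc 0 w from ⟨hτ0, hτw⟩), one_mul,
      chart τ (hlt_half τ hτ0.le le_rfl)]
  · -- outside the window: the torus entrance time is not in `(0, w]`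
    rw [indicator_of_notMem hA]
    suffices h : sInf T ∉ Ioc 0 w by rw [indicator_of_notMem h, zero_mul]
    intro hmem
    apply hA
    obtain ⟨hT0, hTw⟩ := hmem
    have hcont : Continuous fun t : ℝ => ‖Torus.reprSym (y + Torus.proj (t • g))‖ :=
      Torus.continuous_norm_reprSym.comp
        (continuous_const.add (Torus.continuous_proj.comp (continuous_id.smul continuous_const)))
    have hle : ‖Torus.reprSym (y + Torus.proj (sInf T • g))‖ ≤ ε := apply_sInf_le_of_pos hcont hT0
    -- the Euclidean position at the entrance time is in the chart
    set r : V3 := Torus.reprSym (y + Torus.proj (sInf T • g)) with hr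
    have hqr : q = r - sInf T • g := by
      have h1 : y = Torus.proj (r - sInf T • g) := by
        rw [sub_eq_add_neg, Torus.proj_add, Torus.proj_neg, hr, Torus.proj_reprSym]
        abel
      rw [hq, h1, Torus.reprSym_proj_of_norm_lt (back hle hT0.le hTw)]
    have hin : ‖q + sInf T • g‖ ≤ ε := by rw [hqr, sub_add_cancel]; exact hle
    have hout : ∀ s ∈ Ioo 0 (sInf T), ε < ‖q + s • g‖ := by
      intro s hs
      have hs_half : ‖q + s • g‖ < 1 / 2 := by
        have : q + s • g = (q + sInf T • g) - (sInf T - s) • g := by rw [sub_smul]; abel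
        rw [this]
        exact back hin (by linarith [hs.2]) (by linarith [hs.1])
      have hnot : ¬ ‖Torus.reprSym (y + Torus.proj (s • g))‖ ≤ ε := fun hsle =>
        (not_lt.2 (csInf_le hbdd ⟨hs.1, hsle⟩)) hs.2
      rw [chart s hs_half] at hnot
      exact not_le.1 hnot
    obtain ⟨hD, hτ⟩ := pairHitTime_eq_of_first_entrance hg hε.le hT0 hin hout
    exact ⟨hD, by rw [hτ]; exact ⟨hT0, hTw⟩⟩

/-! ## The entrance law on the torus -/

/-- **Brick B3 (registered stub `lintegral_entranceLaw_torus`).** For `g ≠ 0`, `0 < ε < 1/4`, `0 < w` with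
`‖g‖ w ≤ 1/4` and every measurable `H : ℝ × ℝ³ → [0, ∞]`: integrating over the relative position `y ∈ 𝕋³`
(Haar probability measure), the entrance time `t⋆(y) = inf {t > 0 | ‖reprSym (y + proj (t g))‖ ≤ ε}` and the
contact normal `ω⋆ = ε⁻¹ reprSym (y + proj (t⋆ g))`, restricted to `t⋆ ∈ (0, w]`, have the law
`dt ⊗ ε² (−⟪ω, g⟫)₊ dS(ω)`:
`∫_{𝕋³} 1_{(0,w]}(t⋆) H(t⋆, ω⋆) dy = ∫_S ∫_{(0,w]} H(t, ω) ε² (−⟪ω, g⟫)₊ dt dS(ω)`. [folklore] -/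
theorem lintegral_entranceLaw_torus : ∀ (g : Literature.MathematicalPhysics.KineticTheory.V3), g ≠ 0 → ∀ {ε w : ℝ}, 0 < ε → ε < 4⁻¹ → 0 < w → ‖g‖ * w ≤ 4⁻¹ → ∀ (H : ℝ × Literature.MathematicalPhysics.KineticTheory.V3 → ENNReal), Measurable H → ∫⁻ y : Literature.MathematicalPhysics.KineticTheory.T3, (Set.Ioc 0 w).indicator (fun _ => (1 : ENNReal)) (sInf {t : ℝ | 0 < t ∧ ‖Literature.Analysis.FluidPDE.Torus.reprSym (y + Literature.Analysis.FunctionSpaces.Torus.proj (t • g))‖ ≤ ε}) * H (sInf {t : ℝ | 0 < t ∧ ‖Literature.Analysis.FluidPDE.Torus.reprSym (y + Literature.Analysis.FunctionSpaces.Torus.proj (t • g))‖ ≤ ε}, ε⁻¹ • Literature.Analysis.FluidPDE.Torus.reprSym (y + Literature.Analysis.FunctionSpaces.Torus.proj ((sInf {t : ℝ | 0 < t ∧ ‖Literature.Analysis.FluidPDE.Torus.reprSym (y + Literature.Analysis.FunctionSpaces.Torus.proj (t • g))‖ ≤ ε}) • g))) = ∫⁻ ω : Metric.sphere (0 : Literature.MathematicalPhysics.KineticTheory.V3)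 1, (∫⁻ t in Set.Ioc 0 w, H (t, (ω : Literature.MathematicalPhysics.KineticTheory.V3)) * ENNReal.ofReal (ε ^ 2 * max (-inner ℝ (ω : Literature.MathematicalPhysics.KineticTheory.V3) g) 0)) ∂Literature.MathematicalPhysics.KineticTheory.sphereMeasure := by
  intro g hg ε w hε hε4 _hw hgw H hH
  -- the explicit Euclidean entrance data
  set τ : V3 → ℝ := fun q => pairHitTime ε q g with hτdef
  set ωE : V3 → V3 := fun q => ε⁻¹ • (q + pairHitTime ε q g • g) with hωEdef
  set A : Set V3 := {q : V3 | 0 ≤ pairDisc ε q g ∧ pairHitTime ε q g ∈ Ioc 0 w} with hAdef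
  set G : V3 → ℝ≥0∞ := A.indicator fun q => H (pairHitTime ε q g, ε⁻¹ • (q + pairHitTime ε q g • g)) with hGdef
  set H' : ℝ × V3 → ℝ≥0∞ := fun p => (Ioc 0 w).indicator (fun _ => (1 : ℝ≥0∞)) p.1 * H p with hH'def
  have hhalf : ε + w * ‖g‖ < 1 / 2 := by nlinarith
  -- measurability
  have hDm : Measurable fun q : V3 => pairDisc ε q g := by
    have : Continuous fun q : V3 => pairDisc ε q g := by unfold pairDisc; fun_prop
    exact this.measurable
  have hτm : Measurable τ := by
    have : Continuous fun q : V3 => pairHitTime ε q g := by unfold pairHitTime pairDisc; fun_prop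
    exact this.measurable
  have hωm : Measurable ωE := (measurable_id.add (hτm.smul measurable_const)).const_smul ε⁻¹
  have hAm : MeasurableSet A := (measurableSet_le measurable_const hDm).inter (hτm measurableSet_Ioc)
  have hGm : Measurable G := (hH.comp (hτm.prodMk hωm)).indicator hAm
  have hH'm : Measurable H' := ((measurable_const.indicator measurableSet_Ioc).comp measurable_fst).mul hH
  -- (a) the torus integrand is `G ∘ reprSym`
  rw [lintegral_congr fun y => torusIntegrand_eq_indicator_reprSym hg hε hε4 hgw H y]
  change ∫⁻ y : T3, G (Torus.reprSym y) = _
  -- (b) `reprSym` pushes Haar measure to Lebesgue measure on the cube, and `G` lives in the cube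
  rw [(Torus.measurePreserving_reprSym (d := Fin 3)).lintegral_comp hGm]
  have hsupp : Function.support G ⊆ Torus.symCube (Fin 3) := by
    intro q hq
    rw [Function.mem_support] at hq
    have hqA : q ∈ A := by
      by_contra h
      exact hq (indicator_of_notMem h _)
    obtain ⟨hD, hτ0, hτw⟩ := hqA
    have hnorm : ‖q + pairHitTime ε q g • g‖ = ε :=
      norm_add_pairHitTime_smul hε.le (pairHits_of_pairHitTime_pos hg hD hτ0)
    refine Torus.closedBall_subset_symCube hhalf ?_
    rw [mem_closedBall, dist_zero_right]
    calc ‖q‖ = ‖(q + pairHitTime ε q g • g) - pairHitTime ε q g • g‖ := by rw [add_sub_cancel_right]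
      _ ≤ ‖q + pairHitTime ε q g • g‖ + ‖pairHitTime ε q g • g‖ := norm_sub_le _ _
      _ = ε + pairHitTime ε q g * ‖g‖ := by rw [hnorm, norm_smul, Real.norm_of_nonneg hτ0.le]
      _ ≤ ε + w * ‖g‖ := add_le_add le_rfl (mul_le_mul_of_nonneg_right hτw (norm_nonneg g))
  rw [setLIntegral_eq_of_support_subset hsupp]
  -- (c) up to the null grazing cylinder, `G` is the tube integrand of the Euclidean entrance law
  have hae : G =ᵐ[volume] {q : V3 | ∃ t : ℝ, dist q (t • g) < ε}.indicator fun q => H' (τ q, ωE q) := by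
    have hZ : (volume : Measure V3) {q : V3 | pairDisc ε q g = 0} = 0 :=
      volume_setOf_pairDisc_eq_zero hε.ne' hg
    filter_upwards [measure_eq_zero_iff_ae_notMem.1 hZ] with q hq
    have hq' : pairDisc ε q g ≠ 0 := hq
    rcases lt_or_gt_of_ne hq' with hneg | hpos
    · rw [hGdef, indicator_of_notMem (fun h : q ∈ A => (not_le.2 hneg) h.1),
        indicator_of_notMem (fun h : q ∈ {q : V3 | ∃ t : ℝ, dist q (t • g) < ε} => (lt_irrefl (0 : ℝ))
          ((((exists_dist_smul_lt_iff_pairDisc_pos hg hε q).1 h).trans hneg)))]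
    · rw [indicator_of_mem (show q ∈ {q : V3 | ∃ t : ℝ, dist q (t • g) < ε} from
        (exists_dist_smul_lt_iff_pairDisc_pos hg hε q).2 hpos)]
      by_cases hτq : pairHitTime ε q g ∈ Ioc 0 w
      · rw [hGdef, indicator_of_mem (show q ∈ A from ⟨hpos.le, hτq⟩)]
        simp only [hH'def, hτdef, hωEdef, indicator_of_mem hτq, one_mul]
      · rw [hGdef, indicator_of_notMem (fun h : q ∈ A => hτq h.2)]
        simp only [hH'def, hτdef, hωEdef, indicator_of_notMem hτq, zero_mul]
  have hCyl : MeasurableSet {q : V3 | ∃ t : ℝ, dist q (t • g) < ε} := by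
    have : {q : V3 | ∃ t : ℝ, dist q (t • g) < ε} = (fun q : V3 => pairDisc ε q g) ⁻¹' Ioi 0 :=
      Set.ext fun q => exists_dist_smul_lt_iff_pairDisc_pos hg hε q
    rw [this]
    exact hDm measurableSet_Ioi
  rw [lintegral_congr_ae hae, lintegral_indicator hCyl]
  -- (d) the Euclidean entrance law
  have hinv : ∀ (t : ℝ) (ω : V3), ‖ω‖ = 1 → inner ℝ g ω < 0 →
      τ (ε • ω - t • g) = t ∧ ωE (ε • ω - t • g) = ω := fun t ω hω hin =>
    pairHitTime_entrance_leftInverse hg hε t ω hω hin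
  rw [lintegral_entranceLaw_pair g hg hε hτm hωm hinv H' hH'm]
  refine lintegral_congr fun ω => ?_
  rw [finrank_euclideanSpace_fin, ← lintegral_indicator measurableSet_Ioc]
  refine lintegral_congr fun t => ?_
  by_cases ht : t ∈ Ioc 0 w
  · simp only [hH'def, indicator_of_mem ht, one_mul]
  · simp only [hH'def, indicator_of_notMem ht, zero_mul]

end Summit.AtomisticToContinuum.HydrodynamicLimit.Theorems.OLC
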